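import Summits.CriticalPhenomena.PercolationContinuityZ3.Theorems.PercNearOneGluingNoHeavyQuantCatHullCertData0
import Summits.CriticalPhenomena.PercolationContinuityZ3.Theorems.PercNearOneGluingNoHeavyQuantCatHullCertData1
import Summits.CriticalPhenomena.PercolationContinuityZ3.Theorems.PercNearOneGluingNoHeavyQuantCatHullCertData2
import Summits.CriticalPhenomena.PercolationContinuityZ3.Theorems.PercNearOneGluingNoHeavyQuantCatHullCertData3
import Summits.CriticalPhenomena.PercolationContinuityZ3.Theorems.PercNearOneGluingNoHeavyQuantCatHullCertificate2
import Summits.CriticalPhenomena.PercolationContinuityZ3.Theorems.PercNearOneGluingNoHeavyQuantCatHullLeafPieces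
import HarnessLib

/-!
# QUANT lane R8, T-DEC: CERTIFICATE DATA `R8` (assembly) for the light corner `lpT 4 (17/25) (499/680)` at floor `997/2000`

builds on p205010 (kernel theorem, internal audit signed; external expert review pending)

Data file (`--supports stmt-CriticalPhenomena-4575`), census seat prim-quant-census-2 (gen 78).  Definitions only.  [this work].  Nothing here is cited as a published result.  The gluing rows served [cite: KozmaNitzan2024, Conjecture 3 (p. 15)]; product measure [cite: Grimmett1999, §1.3 p. 10].
-/

noncomputable section

namespace Summit.CriticalPhenomena.PercolationContinuityZ3.Theorems
namespace Quant
namespace LawDec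
open Tab

/-- the functional `ψ` of certificate `R8` at offsets `0..10`. [this work] -/
def certPsiR8 : List ℚ := [((-926342747:ℚ)/1073741824), ((-32041831:ℚ)/1073741824), (1:ℚ), ((654279887:ℚ)/1073741824), ((59953547:ℚ)/268435456), ((-172133365:ℚ)/1073741824), (-1:ℚ), ((-536868551:ℚ)/536870912), ((-1072528341:ℚ)/1073741824), ((-507965945:ℚ)/536870912), ((-940509583:ℚ)/1073741824)]

/-- **the certificate `R8`** (floor `997/2000`, `ψ`, eleven tables, bisection fuel `120`). [this work] -/
def certDataR8 : CertData := ⟨(997:ℚ)/2000, certPsiR8, [certTab0, certTab1, certTab2, certTab3, certTab4, certTab5, certTab6, certTab7, certTab8, certTab9, certTab10], 120⟩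

end LawDec
end Quant
end Summit.CriticalPhenomena.PercolationContinuityZ3.Theorems
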